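/-
Copyright (c) 2026. All rights reserved.
Released under Apache 2.0 license as described in the file LICENSE.
-/
import Literature.Probability.LatticeModels.PinningAnchoring
import Literature.Probability.LatticeModels.NoBadPercolationW
import Literature.Probability.LatticeModels.BadPercolationEnclosure
import Literature.Probability.LatticeModels.ShiftLemma
import HarnessLib

/-!
# A good path above the square from two pinnings and a touching (GH2000, Lemma 5.5, Case 3)

Georgii–Higuchi, J. Math. Phys. 41 (2000), proof of Lemma 5.5, Case 3 (p. 15): "By the pinning
lemma and the independence of the two layers, the following event has `ν̂`-probability at least
`(θ/4)²`: in the first layer, `y` is `-∗`connected off `Δ` to `I^-_up(ω)` …; in the second layer,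
`x` is `+∗`connected off `Δ` to `I^{+∗}_up(ω̂)` … Since `γ_up(ω)` and `γ_up(ω̂)` intersect each other
infinitely often by Lemma 5.4, the union of `p^-_y(ω)` and `p^+_x(ω̂)` contains a `∗`path from `x`
to `y` which by construction is a `≤∗`path for the duplicated system."

This file carries out this combination for the pinning events of `PinningLemma` (`PinLeft`, and
its mirror image `PinRightMinus` = pinning of `y` on the right by `-`sites, obtained by the
flip-reflection `ω ↦ -ω ∘ R₀`, `R₀ (x₁, x₂) = (-x₁, x₂)`) and the good-path event `GoodAboveW` of
`NoBadPercolationW` (a good `∗`-walk of *upper winding type*, the shape consumed by the enclosure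
argument `ae_no_bad_percolation_of_goodW`). In place of "intersect infinitely often" (Lemma 5.4) it
takes as **input** a touching of the two layers at height `≥ n > m`:
`TouchAt n (ω, ω̂)` — a site of an infinite `+∗`cluster of `S⁺(ω̂) ∩ {x₂ ≥ n}` equal or adjacent to
a site of an infinite `-`cluster of `S⁻(ω) ∩ {x₂ ≥ n}` — together with a lower bound for its
probability.

* `TouchAt`, `PinRightMinus`, `negRefl` and their measurability / monotonicity;
* `exists_goodAboveW_of_pin_touch` — (deterministic) two pinnings, a touching above height `m` and
  uniqueness of the infinite `±∗`clusters of `S^± ∩ (π_up ∖ Λ_m)` give `GoodAboveW m H x y` for some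
  `H`: the pinned walks have the end shapes and the middle piece (inside the two clusters and the
  touching) stays in `π_up ∖ Λ_m`, so `Percolation.upperType_append` applies;
* **`le_measureReal_goodAboveW_of_pinning`** — for tail-trivial `μ, μ' ∈ 𝒢(β, 0)`, `β > β_c(2)`:
  `ν(TouchAt n) · μ'(PinLeft m x) · μ(PinRightMinus m y) - ε ≤ ν(GoodAboveW m H x y)` for `H`
  large, `ν = μ ⊗ μ'` (positive correlations of increasing/decreasing events in the two layers,
  `prod_measureReal_inter_ge_of_antitone_monotone`, and the almost sure uniqueness
  `ae_starCluster_unique_halfPlane_diff_box`).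

## References

* H.-O. Georgii, Y. Higuchi, J. Math. Phys. 41 (2000) 1153–1169, Lemma 5.5, proof, Case 3
  [GeorgiiHiguchi2000].
-/

namespace Literature.Probability.LatticeModels

open MeasureTheory SimpleGraph Percolation Filter Topology

noncomputable section

/-! ### The events -/

section Events

variable {m : ℕ}

/-- The flip-reflection `ω ↦ -ω ∘ R₀`, `R₀ (x₁, x₂) = (-x₁, x₂)`. [cite: GeorgiiHiguchi2000, §2 (symmetries)] -/
def negRefl (ω : SpinConfig (Site 2)) : SpinConfig (Site 2) := fun z => -ω (reflectCoord 0 z)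

/-- Values of `negRefl`. [folklore] -/
@[simp] theorem negRefl_apply (ω : SpinConfig (Site 2)) (z : Site 2) : negRefl ω z = -ω (reflectCoord 0 z) := rfl

/-- `negRefl` is measurable. [folklore] -/
theorem measurable_negRefl : Measurable negRefl :=
  measurable_neg.comp (measurable_pi_lambda _ fun z => measurable_pi_apply (reflectCoord 0 z))

/-- `negRefl` is antitone. [folklore] -/
theorem negRefl_anti {ω ω' : SpinConfig (Site 2)} (h : ω' ≤ ω) : negRefl ω ≤ negRefl ω' :=
  fun _ => units_neg_le_neg (h _)

/-- **Pinning on the right by `-`sites**: the mirror image of `PinLeft` under the flip-reflection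
(`y` on the right half-axis is joined to the infinite `-∗`structure of `π_up ∖ (Λ_m ∪ ℓ_{≤ m})` by a
`-∗`walk off `Λ_m` whose axis sites lie right of `m`). [cite: GeorgiiHiguchi2000, Lemma 5.2 ("The same holds when 'left' and 'right' … are interchanged")] -/
def PinRightMinus (m : ℕ) (y : Site 2) (ω : SpinConfig (Site 2)) : Prop :=
  PinLeft m (reflectCoord 0 y) (negRefl ω)

/-- `U` grows with the configuration. [folklore] -/
theorem pinU_mono {ω ω' : SpinConfig (Site 2)} (h : ω ≤ ω') : pinU m ω ⊆ pinU m ω' :=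
  fun z ⟨h1, h2⟩ => ⟨le_antisymm (intUnits_le_one _) ((show ω z = 1 from h1) ▸ h z), h2⟩

/-- `J` grows with the configuration. [folklore] -/
theorem pinJ_mono {ω ω' : SpinConfig (Site 2)} (h : ω ≤ ω') : pinJ m ω ⊆ pinJ m ω' :=
  fun z hz => Set.Infinite.mono (siteCluster_mono (pinU_mono h) z) hz

/-- `PinLeft` is increasing. [folklore] -/
theorem pinLeft_mono {x : Site 2} {ω ω' : SpinConfig (Site 2)} (h : ω ≤ ω') (hp : PinLeft m x ω) :
    PinLeft m x ω' := by
  obtain ⟨a, ha, W, hW⟩ := hp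
  exact ⟨a, pinJ_mono h ha, W, fun z hz => ⟨le_antisymm (intUnits_le_one _) ((hW z hz).1 ▸ h z), (hW z hz).2⟩⟩

/-- `PinRightMinus` is decreasing. [folklore] -/
theorem pinRightMinus_anti {y : Site 2} {ω ω' : SpinConfig (Site 2)} (h : ω' ≤ ω) (hp : PinRightMinus m y ω) :
    PinRightMinus m y ω' :=
  pinLeft_mono (negRefl_anti h) hp

/-- `PinRightMinus` is measurable. [folklore] -/
theorem measurableSet_pinRightMinus (y : Site 2) : MeasurableSet {ω : SpinConfig (Site 2) | PinRightMinus m y ω} :=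
  measurable_negRefl (measurableSet_pinLeft (m := m) (reflectCoord 0 y))

/-- `U ⊆ S⁺ ∩ (π_up ∖ Λ_m)`. [folklore] -/
theorem pinU_subset (ω : SpinConfig (Site 2)) : pinU m ω ⊆ spinSites 1 ω ∩ (halfPlane 0 \ ↑(box 2 m)) :=
  fun _ ⟨h1, h2, h3⟩ => ⟨h1, h2, fun h => h3 (Or.inl h)⟩

/-- Boxes are symmetric under `x₁ ↦ -x₁`. [folklore] -/
theorem reflectCoord_zero_mem_box_iff {N : ℕ} {z : Site 2} : reflectCoord 0 z ∈ box 2 N ↔ z ∈ box 2 N := by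
  simp only [mem_box, Fin.forall_fin_two, (reflectCoord_zero_apply z).1, (reflectCoord_zero_apply z).2]; omega

/-- `x₁ ↦ -x₁` is injective. [folklore] -/
theorem reflectCoord_zero_injective : Function.Injective (reflectCoord (d := 2) 0) := fun a b h => by
  have := congrArg (reflectCoord (d := 2) 0) h
  rwa [reflectCoord_reflectCoord, reflectCoord_reflectCoord] at this

/-- A `U`-site of `negRefl ω` reflects to a `-`site of `π_up ∖ Λ_m` for `ω`. [folklore] -/
theorem reflect_mem_of_mem_pinU_negRefl {ω : SpinConfig (Site 2)} {u : Site 2} (hu : u ∈ pinU m (negRefl ω)) :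
    reflectCoord 0 u ∈ spinSites (-1) ω ∩ (halfPlane 0 \ ↑(box 2 m)) := by
  obtain ⟨h1, h2, h3⟩ := hu
  have hc := reflectCoord_zero_apply u
  refine ⟨?_, ?_, fun h => h3 (Or.inl (Finset.mem_coe.2 (reflectCoord_zero_mem_box_iff.1 (Finset.mem_coe.1 h))))⟩
  · rw [mem_spinSites] at h1 ⊢
    have h1' : -ω (reflectCoord 0 u) = 1 := h1
    rw [← neg_neg (ω (reflectCoord 0 u)), h1']
  · show (0 : ℤ) ≤ reflectCoord 0 u 1; rw [hc.2]; exact h2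

/-- **`PinRightMinus` unfolded**: a `-∗`walk off `Λ_m` from `y` to a site whose `-∗`cluster in
`S⁻ ∩ (π_up ∖ Λ_m)` is infinite, with axis sites right of `m`. [cite: GeorgiiHiguchi2000, Lemma 5.2] -/
theorem pinRightMinus_spec {y : Site 2} {ω : SpinConfig (Site 2)} (h : PinRightMinus m y ω) :
    ∃ b : Site 2, (siteCluster zdStarGraph (spinSites (-1) ω ∩ (halfPlane 0 \ ↑(box 2 m))) b).Infinite ∧
      ∃ W : zdStarGraph.Walk y b, ∀ z ∈ W.support, ω z = -1 ∧ z ∉ box 2 m ∧ (z 1 = 0 → (m : ℤ) < z 0) := by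
  obtain ⟨a, ha, W, hW⟩ := h
  refine ⟨reflectCoord 0 a, ?_, (W.map (starReflectHom 0)).copy (reflectCoord_reflectCoord 0 y) rfl, fun z hz => ?_⟩
  · have hsub : reflectCoord 0 '' siteCluster zdStarGraph (pinU m (negRefl ω)) a ⊆
        siteCluster zdStarGraph (spinSites (-1) ω ∩ (halfPlane 0 \ ↑(box 2 m))) (reflectCoord 0 a) := by
      rintro _ ⟨c, hc, rfl⟩
      obtain ⟨w, hw⟩ := exists_walk_in_siteCluster ((mem_siteCluster_self_iff _ _ _).2 hc.1) hc
      have hO : ∀ v ∈ (w.map (starReflectHom 0)).support, v ∈ spinSites (-1) ω ∩ (halfPlane 0 \ ↑(box 2 m)) := by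
        intro v hv
        rw [Walk.support_map, List.mem_map] at hv
        obtain ⟨u, hu, rfl⟩ := hv
        exact reflect_mem_of_mem_pinU_negRefl (mem_of_mem_siteCluster (hw u hu))
      exact ⟨hO _ (Walk.start_mem_support _), hO _ (Walk.end_mem_support _), reachable_siteOpenGraph_of_walk _ hO⟩
    exact (ha.image reflectCoord_zero_injective.injOn).mono hsub
  · rw [Walk.support_copy, Walk.support_map, List.mem_map] at hz
    obtain ⟨u, hu, rfl⟩ := hz
    obtain ⟨h1, h2, h3⟩ := hW u hu
    have hc := reflectCoord_zero_apply u
    refine ⟨?_, fun h => h2 (reflectCoord_zero_mem_box_iff.1 (by rwa [starReflectHom_apply] at h)), fun hz1 => ?_⟩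
    · have h1' : -ω (reflectCoord 0 u) = 1 := h1
      show ω (starReflectHom 0 u) = -1
      rw [starReflectHom_apply, ← neg_neg (ω (reflectCoord 0 u)), h1']
    · rw [starReflectHom_apply, hc.2] at hz1
      rw [starReflectHom_apply, hc.1]
      have := h3 hz1; omega

/-- The reflection `ω ↦ ω ∘ R₀` of configurations. [cite: GeorgiiHiguchi2000, §2 (symmetries)] -/
def refl0 : SpinConfig (Site 2) → SpinConfig (Site 2) := configRelabel (reflectCoord (d := 2) 0).toEquiv

/-- Values of `refl0`. [folklore] -/
@[simp] theorem refl0_apply (ω : SpinConfig (Site 2)) (z : Site 2) : refl0 ω z = ω (reflectCoord 0 z) := by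
  simp [refl0, configRelabel_apply, reflectCoord_symm_apply]

/-- `negRefl ω = refl0 (-ω)`. [folklore] -/
theorem negRefl_eq_refl0_neg (ω : SpinConfig (Site 2)) : negRefl ω = refl0 (-ω) := by
  funext z; simp

/-- `refl0` is measurable. [folklore] -/
theorem measurable_refl0 : Measurable refl0 := (configRelabel _).measurable

/-- `refl0` is monotone. [folklore] -/
theorem refl0_mono {ω ω' : SpinConfig (Site 2)} (h : ω ≤ ω') : refl0 ω ≤ refl0 ω' := fun z => by
  rw [refl0_apply, refl0_apply]; exact h _

/-- **Pinning on the right by `+`sites** (mirror image of `PinLeft` under `R₀`): `y` on the right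
half-axis is joined to the infinite `+∗`structure of `π_up ∖ (Λ_m ∪ ℓ_{≤ m})` by a `+∗`walk off
`Λ_m` whose axis sites lie right of `m`. [cite: GeorgiiHiguchi2000, Lemma 5.2] -/
def PinRightPlus (m : ℕ) (y : Site 2) (ω : SpinConfig (Site 2)) : Prop :=
  PinLeft m (reflectCoord 0 y) (refl0 ω)

/-- `PinRightMinus m y ω ↔ PinRightPlus m y (-ω)`. [folklore] -/
theorem pinRightMinus_iff_pinRightPlus_neg {y : Site 2} {ω : SpinConfig (Site 2)} :
    PinRightMinus m y ω ↔ PinRightPlus m y (-ω) := by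
  rw [PinRightMinus, PinRightPlus, negRefl_eq_refl0_neg]

/-- `PinRightPlus` is increasing. [folklore] -/
theorem pinRightPlus_mono {y : Site 2} {ω ω' : SpinConfig (Site 2)} (h : ω ≤ ω') (hp : PinRightPlus m y ω) :
    PinRightPlus m y ω' :=
  pinLeft_mono (refl0_mono h) hp

/-- `PinRightPlus` is measurable. [folklore] -/
theorem measurableSet_pinRightPlus (y : Site 2) : MeasurableSet {ω : SpinConfig (Site 2) | PinRightPlus m y ω} :=
  measurable_refl0 (measurableSet_pinLeft (m := m) (reflectCoord 0 y))

/-- `ω ↦ PinLeft m x (-ω)` (pinning of `x` on the left by `-`sites) is measurable. [folklore] -/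
theorem measurableSet_pinLeft_neg (x : Site 2) : MeasurableSet {ω : SpinConfig (Site 2) | PinLeft m x (-ω)} :=
  measurable_neg (measurableSet_pinLeft (m := m) x)

/-- **`PinRightPlus` unfolded**: a `+∗`walk off `Λ_m` from `y` to a site whose `+∗`cluster in
`S⁺ ∩ (π_up ∖ Λ_m)` is infinite, with axis sites right of `m`. [cite: GeorgiiHiguchi2000, Lemma 5.2] -/
theorem pinRightPlus_spec {y : Site 2} {ω : SpinConfig (Site 2)} (h : PinRightPlus m y ω) :
    ∃ b : Site 2, (siteCluster zdStarGraph (spinSites 1 ω ∩ (halfPlane 0 \ ↑(box 2 m))) b).Infinite ∧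
      ∃ W : zdStarGraph.Walk y b, ∀ z ∈ W.support, ω z = 1 ∧ z ∉ box 2 m ∧ (z 1 = 0 → (m : ℤ) < z 0) := by
  have h' : PinRightMinus m y (-ω) := by rw [pinRightMinus_iff_pinRightPlus_neg, neg_neg]; exact h
  obtain ⟨b, hb, W, hW⟩ := pinRightMinus_spec h'
  refine ⟨b, by simpa only [spinSites_neg_config, neg_neg] using hb, W, fun z hz => ⟨?_, (hW z hz).2⟩⟩
  have := (hW z hz).1
  rw [Pi.neg_apply, neg_eq_iff_eq_neg, neg_neg] at this
  exact this

/-- **`PinLeft m x (-ω)` unfolded**: a `-∗`walk off `Λ_m` from `x` to a site whose `-∗`cluster in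
`S⁻ ∩ (π_up ∖ Λ_m)` is infinite, with axis sites left of `-m`. [cite: GeorgiiHiguchi2000, Lemma 5.2] -/
theorem pinLeft_neg_spec {x : Site 2} {ω : SpinConfig (Site 2)} (h : PinLeft m x (-ω)) :
    ∃ a : Site 2, (siteCluster zdStarGraph (spinSites (-1) ω ∩ (halfPlane 0 \ ↑(box 2 m))) a).Infinite ∧
      ∃ W : zdStarGraph.Walk x a, ∀ z ∈ W.support, ω z = -1 ∧ z ∉ box 2 m ∧ (z 1 = 0 → z 0 < -(m : ℤ)) := by
  obtain ⟨a, ha, W, hW⟩ := h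
  refine ⟨a, ?_, W, fun z hz => ⟨?_, (hW z hz).2⟩⟩
  · have h1 := ha.mono (siteCluster_mono (pinU_subset (-ω)) a)
    simpa only [spinSites_neg_config] using h1
  · have := (hW z hz).1
    rw [Pi.neg_apply, neg_eq_iff_eq_neg] at this
    exact this

/-- **The touching event at height `n`**: a site of an infinite `+∗`cluster of `S⁺(ω̂) ∩ {x₂ ≥ n}`
coincides with, or is a lattice neighbour of, a site of an infinite `-`cluster of
`S⁻(ω) ∩ {x₂ ≥ n}`. [cite: GeorgiiHiguchi2000, Lemma 5.4 and Lemma 5.5 (proof, Case 3: "`γ_up(ω)` and `γ_up(ω̂)` intersect each other")] -/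
def TouchAt (n : ℕ) (p : SpinConfig (Site 2) × SpinConfig (Site 2)) : Prop :=
  ∃ z z' : Site 2, (z = z' ∨ (zdGraph 2).Adj z z') ∧
    (siteCluster zdStarGraph (spinSites 1 p.2 ∩ halfPlane n) z).Infinite ∧
    (siteCluster (zdGraph 2) (spinSites (-1) p.1 ∩ halfPlane n) z').Infinite

/-- The touching event is measurable. [folklore] -/
theorem measurableSet_touchAt (n : ℕ) : MeasurableSet {p : SpinConfig (Site 2) × SpinConfig (Site 2) | TouchAt n p} := by
  have : {p : SpinConfig (Site 2) × SpinConfig (Site 2) | TouchAt n p} = ⋃ z : Site 2, ⋃ z' : Site 2,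
      ⋃ (_ : z = z' ∨ (zdGraph 2).Adj z z'),
        (Prod.snd ⁻¹' {ω | (siteCluster zdStarGraph (spinSites 1 ω ∩ halfPlane n) z).Infinite}) ∩
        (Prod.fst ⁻¹' {ω | (siteCluster (zdGraph 2) (spinSites (-1) ω ∩ halfPlane n) z').Infinite}) := by
    ext p
    simp only [TouchAt, Set.mem_setOf_eq, Set.mem_iUnion, Set.mem_inter_iff, Set.mem_preimage, exists_prop]
  rw [this]
  exact MeasurableSet.iUnion fun z => MeasurableSet.iUnion fun z' => MeasurableSet.iUnion fun _ =>
    (measurable_snd (measurable_spinSites_inter 1 _ (measurableSet_sitePercolatesAt (G := zdStarGraph) z))).inter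
      (measurable_fst (measurable_spinSites_inter (-1) _ (measurableSet_sitePercolatesAt (G := zdGraph 2) z')))

/-- The touching event is decreasing in `ω` and increasing in `ω̂`. [folklore] -/
theorem touchAt_mono {n : ℕ} (p q : SpinConfig (Site 2) × SpinConfig (Site 2)) (h1 : q.1 ≤ p.1) (h2 : p.2 ≤ q.2)
    (hp : TouchAt n p) : TouchAt n q := by
  obtain ⟨z, z', hzz', hz, hz'⟩ := hp
  exact ⟨z, z', hzz', hz.mono (siteCluster_mono (Set.inter_subset_inter_left _ (spinSites_one_mono h2)) z),
    hz'.mono (siteCluster_mono (Set.inter_subset_inter_left _ (spinSites_neg_one_anti h1)) z')⟩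

end Events

/-! ### The deterministic combination -/

section Det

variable {m n : ℕ} {ω ω' : SpinConfig (Site 2)}

/-- A lattice cluster is contained in the `∗`cluster. [folklore] -/
theorem siteCluster_zd_subset_star (O : Set (Site 2)) (x : Site 2) :
    siteCluster (zdGraph 2) O x ⊆ siteCluster zdStarGraph O x := fun _ ⟨h1, h2, h3⟩ =>
  ⟨h1, h2, h3.mono fun a b hab => by
    rw [siteOpenGraph_adj] at hab ⊢
    exact ⟨zdGraph_le_zdStarGraph hab.1, hab.2⟩⟩

/-- Sites of `{x₂ ≥ n}`, `n > m`, lie in `π_up ∖ Λ_m`. [folklore] -/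
theorem inter_halfPlane_subset (hmn : m < n) (S : Set (Site 2)) :
    S ∩ halfPlane n ⊆ S ∩ (halfPlane 0 \ ↑(box 2 m)) := by
  rintro z ⟨hz, hzn⟩
  have hzn' : (n : ℤ) ≤ z 1 := hzn
  refine ⟨hz, show (0 : ℤ) ≤ z 1 by omega, fun h => ?_⟩
  have := (mem_box.1 (Finset.mem_coe.1 h) 1).2
  omega

/-- **Two pinnings and a touching give a good path of upper type** (Georgii–Higuchi 2000, proof
of Lemma 5.5, Case 3: "the union of `p^-_y(ω)` and `p^+_x(ω̂)` contains a `∗`path from `x` to `y`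
which by construction is a `≤∗`path"), given uniqueness of the infinite `+∗`cluster of
`S⁺(ω̂) ∩ (π_up ∖ Λ_m)` and of the infinite `-∗`cluster of `S⁻(ω) ∩ (π_up ∖ Λ_m)`. [cite: GeorgiiHiguchi2000, Lemma 5.5 (proof, Case 3, p. 15)] -/
theorem exists_goodAboveW_of_pin_touch (hm : 1 ≤ m) (hmn : m < n) {x y : Site 2} (hy1 : y 1 = 0)
    (huq : ∀ x₁ x₂, (siteCluster zdStarGraph (spinSites 1 ω' ∩ (halfPlane 0 \ ↑(box 2 m))) x₁).Infinite →
      (siteCluster zdStarGraph (spinSites 1 ω' ∩ (halfPlane 0 \ ↑(box 2 m))) x₂).Infinite →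
      x₂ ∈ siteCluster zdStarGraph (spinSites 1 ω' ∩ (halfPlane 0 \ ↑(box 2 m))) x₁)
    (hum : ∀ x₁ x₂, (siteCluster zdStarGraph (spinSites (-1) ω ∩ (halfPlane 0 \ ↑(box 2 m))) x₁).Infinite →
      (siteCluster zdStarGraph (spinSites (-1) ω ∩ (halfPlane 0 \ ↑(box 2 m))) x₂).Infinite →
      x₂ ∈ siteCluster zdStarGraph (spinSites (-1) ω ∩ (halfPlane 0 \ ↑(box 2 m))) x₁)
    (hpx : PinLeft m x ω') (hpy : PinRightMinus m y ω) (ht : TouchAt n (ω, ω')) :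
    ∃ H, GoodAboveW m H x y (ω, ω') := by
  classical
  set Up := spinSites 1 ω' ∩ (halfPlane 0 \ ↑(box 2 m)) with hUp
  set Um := spinSites (-1) ω ∩ (halfPlane 0 \ ↑(box 2 m)) with hUm
  obtain ⟨a, haJ, Px, hPx⟩ := hpx
  obtain ⟨b, hb, Py, hPy⟩ := pinRightMinus_spec hpy
  obtain ⟨z, z', hzz', hz, hz'⟩ := ht
  -- the clusters reached
  have haU : (siteCluster zdStarGraph Up a).Infinite := haJ.mono (siteCluster_mono (pinU_subset ω') a)
  have hzU : (siteCluster zdStarGraph Up z).Infinite := hz.mono (siteCluster_mono (inter_halfPlane_subset hmn _) z)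
  have hz'U : (siteCluster zdStarGraph Um z').Infinite :=
    (hz'.mono (siteCluster_zd_subset_star _ z')).mono (siteCluster_mono (inter_halfPlane_subset hmn _) z')
  -- the middle pieces
  have haself : a ∈ siteCluster zdStarGraph Up a := (mem_siteCluster_self_iff _ _ _).2 haU.nonempty.some_mem.1
  have hz'self : z' ∈ siteCluster zdStarGraph Um z' := (mem_siteCluster_self_iff _ _ _).2 hz'U.nonempty.some_mem.1
  obtain ⟨M₁, hM₁⟩ := exists_walk_in_siteCluster haself (huq a z haU hzU)
  obtain ⟨M₂, hM₂⟩ := exists_walk_in_siteCluster hz'self (hum z' b hz'U hb)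
  have hbridge : ∃ B : zdStarGraph.Walk z z', ∀ v ∈ B.support, v = z ∨ v = z' := by
    rcases hzz' with rfl | hadj
    · exact ⟨Walk.nil, fun v hv => by rw [Walk.support_nil, List.mem_singleton] at hv; exact Or.inl hv⟩
    · exact ⟨Walk.cons (zdGraph_le_zdStarGraph hadj) Walk.nil, fun v hv => by simpa using hv⟩
  obtain ⟨B, hB⟩ := hbridge
  set M : zdStarGraph.Walk a b := M₁.append (B.append M₂) with hM
  have hzUp : z ∈ Up := (huq a z haU hzU).2.1
  have hz'Um : z' ∈ Um := hz'self.2.1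
  have hMsites : ∀ v ∈ M.support, v ∈ Up ∨ v ∈ Um := by
    intro v hv
    rw [hM, Walk.mem_support_append_iff, Walk.mem_support_append_iff] at hv
    rcases hv with hv | hv | hv
    · exact Or.inl (hM₁ v hv).2.1
    · rcases hB v hv with rfl | rfl
      · exact Or.inl hzUp
      · exact Or.inr hz'Um
    · exact Or.inr (hM₂ v hv).2.1
  have hMu : ∀ v ∈ M.support, 0 ≤ v 1 ∧ v ∉ box 2 m := by
    intro v hv
    rcases hMsites v hv with ⟨-, h0, hb⟩ | ⟨-, h0, hb⟩
    · exact ⟨h0, fun h => hb (Finset.mem_coe.2 h)⟩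
    · exact ⟨h0, fun h => hb (Finset.mem_coe.2 h)⟩
  have hgoodM : ∀ v ∈ M.support, v ∉ spinSites 1 (badConfig (ω, ω')) := by
    intro v hv
    refine not_mem_spinSites_badConfig_of_le ?_
    rcases hMsites v hv with ⟨h1, -⟩ | ⟨h1, -⟩
    · show ω v ≤ ω' v; rw [show ω' v = 1 from h1]; exact intUnits_le_one _
    · show ω v ≤ ω' v; rw [show ω v = -1 from h1]; exact neg_one_le_intUnits _
  -- assemble
  set α : zdStarGraph.Walk x y := Px.append (M.append Py.reverse) with hα
  have hUT : UpperType m α :=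
    upperType_append hm Px M Py (fun v hv => (hPx v hv).2) hMu (fun v hv => (hPy v hv).2) hy1
  obtain ⟨H, hH⟩ := exists_box_of_list α.support
  refine ⟨H, α, hUT, fun v hv => ⟨?_, hH v hv⟩⟩
  rw [hα, Walk.mem_support_append_iff, Walk.mem_support_append_iff, Walk.support_reverse, List.mem_reverse] at hv
  rcases hv with hv | hv | hv
  · refine not_mem_spinSites_badConfig_of_le ?_
    show ω v ≤ ω' v; rw [(hPx v hv).1]; exact intUnits_le_one _
  · exact hgoodM v hv
  · refine not_mem_spinSites_badConfig_of_le ?_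
    show ω v ≤ ω' v; rw [(hPy v hv).1]; exact neg_one_le_intUnits _

/-- **Two pinnings and a touching give a good path of upper type, mirror-image orientation**
(`x` pinned on the left by `-`sites of the first layer, `y` pinned on the right by `+`sites of
the second layer). [cite: GeorgiiHiguchi2000, Lemma 5.5 (proof, Case 3, p. 15: "for definiteness")] -/
theorem exists_goodAboveW_of_pin_touch' (hm : 1 ≤ m) (hmn : m < n) {x y : Site 2} (hy1 : y 1 = 0)
    (huq : ∀ x₁ x₂, (siteCluster zdStarGraph (spinSites 1 ω' ∩ (halfPlane 0 \ ↑(box 2 m))) x₁).Infinite →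
      (siteCluster zdStarGraph (spinSites 1 ω' ∩ (halfPlane 0 \ ↑(box 2 m))) x₂).Infinite →
      x₂ ∈ siteCluster zdStarGraph (spinSites 1 ω' ∩ (halfPlane 0 \ ↑(box 2 m))) x₁)
    (hum : ∀ x₁ x₂, (siteCluster zdStarGraph (spinSites (-1) ω ∩ (halfPlane 0 \ ↑(box 2 m))) x₁).Infinite →
      (siteCluster zdStarGraph (spinSites (-1) ω ∩ (halfPlane 0 \ ↑(box 2 m))) x₂).Infinite →
      x₂ ∈ siteCluster zdStarGraph (spinSites (-1) ω ∩ (halfPlane 0 \ ↑(box 2 m))) x₁)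
    (hpx : PinLeft m x (-ω)) (hpy : PinRightPlus m y ω') (ht : TouchAt n (ω, ω')) :
    ∃ H, GoodAboveW m H x y (ω, ω') := by
  classical
  set Up := spinSites 1 ω' ∩ (halfPlane 0 \ ↑(box 2 m)) with hUp
  set Um := spinSites (-1) ω ∩ (halfPlane 0 \ ↑(box 2 m)) with hUm
  obtain ⟨a, ha, Px, hPx⟩ := pinLeft_neg_spec hpx
  obtain ⟨b, hb, Py, hPy⟩ := pinRightPlus_spec hpy
  obtain ⟨z, z', hzz', hz, hz'⟩ := ht
  have hzU : (siteCluster zdStarGraph Up z).Infinite := hz.mono (siteCluster_mono (inter_halfPlane_subset hmn _) z)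
  have hz'U : (siteCluster zdStarGraph Um z').Infinite :=
    (hz'.mono (siteCluster_zd_subset_star _ z')).mono (siteCluster_mono (inter_halfPlane_subset hmn _) z')
  have haself : a ∈ siteCluster zdStarGraph Um a := (mem_siteCluster_self_iff _ _ _).2 ha.nonempty.some_mem.1
  have hzself : z ∈ siteCluster zdStarGraph Up z := (mem_siteCluster_self_iff _ _ _).2 hzU.nonempty.some_mem.1
  obtain ⟨M₁, hM₁⟩ := exists_walk_in_siteCluster haself (hum a z' ha hz'U)
  obtain ⟨M₂, hM₂⟩ := exists_walk_in_siteCluster hzself (huq z b hzU hb)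
  have hbridge : ∃ B : zdStarGraph.Walk z' z, ∀ v ∈ B.support, v = z' ∨ v = z := by
    rcases hzz' with rfl | hadj
    · exact ⟨Walk.nil, fun v hv => by rw [Walk.support_nil, List.mem_singleton] at hv; exact Or.inl hv⟩
    · exact ⟨Walk.cons (zdGraph_le_zdStarGraph hadj.symm) Walk.nil, fun v hv => by simpa using hv⟩
  obtain ⟨B, hB⟩ := hbridge
  set M : zdStarGraph.Walk a b := M₁.append (B.append M₂) with hM
  have hzUp : z ∈ Up := hzself.2.1
  have hz'Um : z' ∈ Um := (hum a z' ha hz'U).2.1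
  have hMsites : ∀ v ∈ M.support, v ∈ Up ∨ v ∈ Um := by
    intro v hv
    rw [hM, Walk.mem_support_append_iff, Walk.mem_support_append_iff] at hv
    rcases hv with hv | hv | hv
    · exact Or.inr (hM₁ v hv).2.1
    · rcases hB v hv with rfl | rfl
      · exact Or.inr hz'Um
      · exact Or.inl hzUp
    · exact Or.inl (hM₂ v hv).2.1
  have hMu : ∀ v ∈ M.support, 0 ≤ v 1 ∧ v ∉ box 2 m := by
    intro v hv
    rcases hMsites v hv with ⟨-, h0, hb⟩ | ⟨-, h0, hb⟩
    · exact ⟨h0, fun h => hb (Finset.mem_coe.2 h)⟩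
    · exact ⟨h0, fun h => hb (Finset.mem_coe.2 h)⟩
  have hgoodM : ∀ v ∈ M.support, v ∉ spinSites 1 (badConfig (ω, ω')) := by
    intro v hv
    refine not_mem_spinSites_badConfig_of_le ?_
    rcases hMsites v hv with ⟨h1, -⟩ | ⟨h1, -⟩
    · show ω v ≤ ω' v; rw [show ω' v = 1 from h1]; exact intUnits_le_one _
    · show ω v ≤ ω' v; rw [show ω v = -1 from h1]; exact neg_one_le_intUnits _
  set α : zdStarGraph.Walk x y := Px.append (M.append Py.reverse) with hα
  have hUT : UpperType m α :=
    upperType_append hm Px M Py (fun v hv => (hPx v hv).2) hMu (fun v hv => (hPy v hv).2) hy1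
  obtain ⟨H, hH⟩ := exists_box_of_list α.support
  refine ⟨H, α, hUT, fun v hv => ⟨?_, hH v hv⟩⟩
  rw [hα, Walk.mem_support_append_iff, Walk.mem_support_append_iff, Walk.support_reverse, List.mem_reverse] at hv
  rcases hv with hv | hv | hv
  · refine not_mem_spinSites_badConfig_of_le ?_
    show ω v ≤ ω' v; rw [(hPx v hv).1]; exact neg_one_le_intUnits _
  · exact hgoodM v hv
  · refine not_mem_spinSites_badConfig_of_le ?_
    show ω v ≤ ω' v; rw [(hPy v hv).1]; exact intUnits_le_one _

end Det

/-! ### The probability bound -/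

section Prob

variable {β : ℝ} {μ : Measure (SpinConfig (Site 2))}

/-- Almost sure uniqueness of the infinite `-∗`cluster of `S⁻ ∩ (π_up ∖ Λ_m)` (flip of
`ae_starCluster_unique_halfPlane_diff_box`). [cite: GeorgiiHiguchi2000, Lemma 5.2 (proof)] -/
theorem ae_starCluster_unique_halfPlane_diff_box_neg (hβc : criticalBeta 2 < β) (hμ : μ ∈ isingGibbsMeasures 2 β 0)
    (m : ℕ) :
    ∀ᵐ ω ∂μ, ∀ x₁ x₂, (siteCluster zdStarGraph (spinSites (-1) ω ∩ (halfPlane 0 \ ↑(box 2 m))) x₁).Infinite →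
      (siteCluster zdStarGraph (spinSites (-1) ω ∩ (halfPlane 0 \ ↑(box 2 m))) x₂).Infinite →
      x₂ ∈ siteCluster zdStarGraph (spinSites (-1) ω ∩ (halfPlane 0 \ ↑(box 2 m))) x₁ := by
  have hμG : IsGibbsMeasure (isingSpecification (zdGraph 2) β 0) μ := hμ
  have hμ' : (μ.map fun σ : SpinConfig (Site 2) => -σ) ∈ isingGibbsMeasures 2 β 0 := isGibbsMeasure_map_neg (zdGraph 2) β hμG
  have h := ae_starCluster_unique_halfPlane_diff_box hβc hμ' m
  have h2 := ae_of_ae_map measurable_neg.aemeasurable h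
  filter_upwards [h2] with ω hω
  simpa only [spinSites_neg_config] using hω

/-- **Good paths above the square from pinnings and a touching** (Georgii–Higuchi 2000, proof of
Lemma 5.5, Case 3, with the touching as input): for `β > β_c(2)`, tail-trivial `μ, μ' ∈ 𝒢(β, 0)`,
`1 ≤ m < n`, an axis site `y` and any `x`,
`ν(TouchAt n) · μ'(PinLeft m x) · μ(PinRightMinus m y) - ε ≤ ν(GoodAboveW m H x y)` for all large
`H`, where `ν = μ ⊗ μ'`. [cite: GeorgiiHiguchi2000, Lemma 5.5 (proof, Case 3, p. 15)] -/
theorem le_measureReal_goodAboveW_of_pinning (hβc : criticalBeta 2 < β) (hμ : μ ∈ isingGibbsMeasures 2 β 0)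
    (hμt : IsTailTrivial μ) {μ' : Measure (SpinConfig (Site 2))} (hμ' : μ' ∈ isingGibbsMeasures 2 β 0)
    (hμ't : IsTailTrivial μ') {m n : ℕ} (hm : 1 ≤ m) (hmn : m < n) (x y : Site 2) (hy1 : y 1 = 0)
    {cT cx cy : ℝ} (hcx : 0 ≤ cx) (hcy : 0 ≤ cy)
    (hT : cT ≤ (μ.prod μ').real {p | TouchAt n p}) (hpx : cx ≤ μ'.real {ω | PinLeft m x ω})
    (hpy : cy ≤ μ.real {ω | PinRightMinus m y ω}) {ε : ℝ} (hε : 0 < ε) :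
    ∃ H₀ : ℕ, ∀ H, H₀ ≤ H → cT * cx * cy - ε ≤ (μ.prod μ').real {p | GoodAboveW m H x y p} := by
  classical
  have hβ : 0 ≤ β := (criticalBeta_nonneg 2).trans hβc.le
  have hμG : IsGibbsMeasure (isingSpecification (zdGraph 2) β 0) μ := hμ
  have hμ'G : IsGibbsMeasure (isingSpecification (zdGraph 2) β 0) μ' := hμ'
  haveI := hμG.isProbabilityMeasure
  haveI := hμ'G.isProbabilityMeasure
  set ν := μ.prod μ' with hν
  set T : Set (SpinConfig (Site 2) × SpinConfig (Site 2)) := {p | TouchAt n p} with hTdef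
  set PX : Set (SpinConfig (Site 2) × SpinConfig (Site 2)) := {p | PinLeft m x p.2} with hPX
  set PY : Set (SpinConfig (Site 2) × SpinConfig (Site 2)) := {p | PinRightMinus m y p.1} with hPY
  have hTm : MeasurableSet T := measurableSet_touchAt n
  have hPXm : MeasurableSet PX := measurable_snd (measurableSet_pinLeft (m := m) x)
  have hPYm : MeasurableSet PY := measurable_fst (measurableSet_pinRightMinus (m := m) y)
  have hT_mono : ∀ p q : SpinConfig (Site 2) × SpinConfig (Site 2), q.1 ≤ p.1 → p.2 ≤ q.2 → p ∈ T → q ∈ T :=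
    fun p q h1 h2 hp => touchAt_mono p q h1 h2 hp
  have hPX_mono : ∀ p q : SpinConfig (Site 2) × SpinConfig (Site 2), q.1 ≤ p.1 → p.2 ≤ q.2 → p ∈ PX → q ∈ PX :=
    fun p q _ h2 hp => pinLeft_mono h2 hp
  have hPY_mono : ∀ p q : SpinConfig (Site 2) × SpinConfig (Site 2), q.1 ≤ p.1 → p.2 ≤ q.2 → p ∈ PY → q ∈ PY :=
    fun p q h1 _ hp => pinRightMinus_anti h1 hp
  -- positive correlations
  have hfkg1 := prod_measureReal_inter_ge_of_antitone_monotone hβ hβ hμ hμt hμ' hμ't hTm hPXm hT_mono hPX_mono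
  have hfkg2 := prod_measureReal_inter_ge_of_antitone_monotone hβ hβ hμ hμt hμ' hμ't (hTm.inter hPXm) hPYm
    (fun p q h1 h2 hp => ⟨hT_mono p q h1 h2 hp.1, hPX_mono p q h1 h2 hp.2⟩) hPY_mono
  have hmargx : ν.real PX = μ'.real {ω | PinLeft m x ω} := by
    rw [hPX, measureReal_def, measureReal_def,
      show {p : SpinConfig (Site 2) × SpinConfig (Site 2) | PinLeft m x p.2} = Set.univ ×ˢ {ω | PinLeft m x ω} by
        ext p; simp [Set.mem_prod], hν, Measure.prod_prod, measure_univ, one_mul]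
  have hmargy : ν.real PY = μ.real {ω | PinRightMinus m y ω} := by
    rw [hPY, measureReal_def, measureReal_def,
      show {p : SpinConfig (Site 2) × SpinConfig (Site 2) | PinRightMinus m y p.1} = {ω | PinRightMinus m y ω} ×ˢ Set.univ by
        ext p; simp [Set.mem_prod], hν, Measure.prod_prod, measure_univ, mul_one]
  have hprod : cT * cx * cy ≤ ν.real (T ∩ PX ∩ PY) := by
    rw [hmargx] at hfkg1; rw [hmargy] at hfkg2
    calc cT * cx * cy ≤ ν.real T * μ'.real {ω | PinLeft m x ω} * μ.real {ω | PinRightMinus m y ω} :=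
          mul_le_mul (mul_le_mul hT hpx hcx measureReal_nonneg) hpy hcy (mul_nonneg measureReal_nonneg measureReal_nonneg)
      _ ≤ ν.real (T ∩ PX) * μ.real {ω | PinRightMinus m y ω} := mul_le_mul_of_nonneg_right hfkg1 measureReal_nonneg
      _ ≤ ν.real (T ∩ PX ∩ PY) := hfkg2
  -- the almost sure inclusion in `⋃_H GoodAboveW m H x y`
  have hae1 := (Measure.quasiMeasurePreserving_fst (μ := μ) (ν := μ')).ae (ae_starCluster_unique_halfPlane_diff_box_neg hβc hμ m)
  have hae2 := (Measure.quasiMeasurePreserving_snd (μ := μ) (ν := μ')).ae (ae_starCluster_unique_halfPlane_diff_box hβc hμ' m)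
  have hincl : ∀ᵐ p ∂ν, p ∈ T ∩ PX ∩ PY → p ∈ ⋃ H : ℕ, {p | GoodAboveW m H x y p} := by
    filter_upwards [hae1, hae2] with p hum huq ⟨⟨hpT, hpX⟩, hpY⟩
    obtain ⟨H, hH⟩ := exists_goodAboveW_of_pin_touch (ω := p.1) (ω' := p.2) hm hmn hy1 huq hum hpX hpY hpT
    exact Set.mem_iUnion.2 ⟨H, hH⟩
  have hU : cT * cx * cy ≤ (ν (⋃ H : ℕ, {p | GoodAboveW m H x y p})).toReal :=
    hprod.trans (ENNReal.toReal_mono (measure_ne_top _ _) (measure_mono_ae hincl))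
  -- continuity from below in `H`
  have hmono : Monotone fun H : ℕ => {p : SpinConfig (Site 2) × SpinConfig (Site 2) | GoodAboveW m H x y p} := by
    intro H H' hH p ⟨α, hUα, hα⟩
    exact ⟨α, hUα, fun v hv => ⟨(hα v hv).1, box_mono 2 hH (hα v hv).2⟩⟩
  have hlim : Tendsto (fun H : ℕ => ν.real {p | GoodAboveW m H x y p}) atTop
      (𝓝 ((ν (⋃ H : ℕ, {p | GoodAboveW m H x y p})).toReal)) :=
    (ENNReal.tendsto_toReal (measure_ne_top _ _)).comp (tendsto_measure_iUnion_atTop hmono)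
  obtain ⟨H₀, hH₀⟩ := eventually_atTop.1 (hlim.eventually (Ioi_mem_nhds
    (show (ν (⋃ H : ℕ, {p | GoodAboveW m H x y p})).toReal - ε < (ν (⋃ H : ℕ, {p | GoodAboveW m H x y p})).toReal by
      linarith)))
  refine ⟨H₀, fun H hH => ?_⟩
  have h' : (ν (⋃ H : ℕ, {p | GoodAboveW m H x y p})).toReal - ε < ν.real {p | GoodAboveW m H x y p} := hH₀ H hH
  linarith

/-- **Good paths above the square from pinnings and a touching, mirror-image orientation**: as
`le_measureReal_goodAboveW_of_pinning`, with `x` pinned on the left by `-`sites of the first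
layer and `y` pinned on the right by `+`sites of the second layer. [cite: GeorgiiHiguchi2000, Lemma 5.5 (proof, Case 3, p. 15)] -/
theorem le_measureReal_goodAboveW_of_pinning' (hβc : criticalBeta 2 < β) (hμ : μ ∈ isingGibbsMeasures 2 β 0)
    (hμt : IsTailTrivial μ) {μ' : Measure (SpinConfig (Site 2))} (hμ' : μ' ∈ isingGibbsMeasures 2 β 0)
    (hμ't : IsTailTrivial μ') {m n : ℕ} (hm : 1 ≤ m) (hmn : m < n) (x y : Site 2) (hy1 : y 1 = 0)
    {cT cx cy : ℝ} (hcx : 0 ≤ cx) (hcy : 0 ≤ cy)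
    (hT : cT ≤ (μ.prod μ').real {p | TouchAt n p}) (hpx : cx ≤ μ.real {ω | PinLeft m x (-ω)})
    (hpy : cy ≤ μ'.real {ω | PinRightPlus m y ω}) {ε : ℝ} (hε : 0 < ε) :
    ∃ H₀ : ℕ, ∀ H, H₀ ≤ H → cT * cx * cy - ε ≤ (μ.prod μ').real {p | GoodAboveW m H x y p} := by
  classical
  have hβ : 0 ≤ β := (criticalBeta_nonneg 2).trans hβc.le
  have hμG : IsGibbsMeasure (isingSpecification (zdGraph 2) β 0) μ := hμ
  have hμ'G : IsGibbsMeasure (isingSpecification (zdGraph 2) β 0) μ' := hμ'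
  haveI := hμG.isProbabilityMeasure
  haveI := hμ'G.isProbabilityMeasure
  set ν := μ.prod μ' with hν
  set T : Set (SpinConfig (Site 2) × SpinConfig (Site 2)) := {p | TouchAt n p} with hTdef
  set PX : Set (SpinConfig (Site 2) × SpinConfig (Site 2)) := {p | PinLeft m x (-p.1)} with hPX
  set PY : Set (SpinConfig (Site 2) × SpinConfig (Site 2)) := {p | PinRightPlus m y p.2} with hPY
  have hTm : MeasurableSet T := measurableSet_touchAt n
  have hPXm : MeasurableSet PX := measurable_fst (measurableSet_pinLeft_neg (m := m) x)
  have hPYm : MeasurableSet PY := measurable_snd (measurableSet_pinRightPlus (m := m) y)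
  have hT_mono : ∀ p q : SpinConfig (Site 2) × SpinConfig (Site 2), q.1 ≤ p.1 → p.2 ≤ q.2 → p ∈ T → q ∈ T :=
    fun p q h1 h2 hp => touchAt_mono p q h1 h2 hp
  have hPX_mono : ∀ p q : SpinConfig (Site 2) × SpinConfig (Site 2), q.1 ≤ p.1 → p.2 ≤ q.2 → p ∈ PX → q ∈ PX :=
    fun p q h1 _ hp => pinLeft_mono (fun z => units_neg_le_neg (h1 z)) hp
  have hPY_mono : ∀ p q : SpinConfig (Site 2) × SpinConfig (Site 2), q.1 ≤ p.1 → p.2 ≤ q.2 → p ∈ PY → q ∈ PY :=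
    fun p q _ h2 hp => pinRightPlus_mono h2 hp
  have hfkg1 := prod_measureReal_inter_ge_of_antitone_monotone hβ hβ hμ hμt hμ' hμ't hTm hPXm hT_mono hPX_mono
  have hfkg2 := prod_measureReal_inter_ge_of_antitone_monotone hβ hβ hμ hμt hμ' hμ't (hTm.inter hPXm) hPYm
    (fun p q h1 h2 hp => ⟨hT_mono p q h1 h2 hp.1, hPX_mono p q h1 h2 hp.2⟩) hPY_mono
  have hmargx : ν.real PX = μ.real {ω | PinLeft m x (-ω)} := by
    rw [hPX, measureReal_def, measureReal_def,
      show {p : SpinConfig (Site 2) × SpinConfig (Site 2) | PinLeft m x (-p.1)} = {ω | PinLeft m x (-ω)} ×ˢ Set.univ by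
        ext p; simp [Set.mem_prod], hν, Measure.prod_prod, measure_univ, mul_one]
  have hmargy : ν.real PY = μ'.real {ω | PinRightPlus m y ω} := by
    rw [hPY, measureReal_def, measureReal_def,
      show {p : SpinConfig (Site 2) × SpinConfig (Site 2) | PinRightPlus m y p.2} = Set.univ ×ˢ {ω | PinRightPlus m y ω} by
        ext p; simp [Set.mem_prod], hν, Measure.prod_prod, measure_univ, one_mul]
  have hprod : cT * cx * cy ≤ ν.real (T ∩ PX ∩ PY) := by
    rw [hmargx] at hfkg1; rw [hmargy] at hfkg2
    calc cT * cx * cy ≤ ν.real T * μ.real {ω | PinLeft m x (-ω)} * μ'.real {ω | PinRightPlus m y ω} :=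
          mul_le_mul (mul_le_mul hT hpx hcx measureReal_nonneg) hpy hcy (mul_nonneg measureReal_nonneg measureReal_nonneg)
      _ ≤ ν.real (T ∩ PX) * μ'.real {ω | PinRightPlus m y ω} := mul_le_mul_of_nonneg_right hfkg1 measureReal_nonneg
      _ ≤ ν.real (T ∩ PX ∩ PY) := hfkg2
  have hae1 := (Measure.quasiMeasurePreserving_fst (μ := μ) (ν := μ')).ae (ae_starCluster_unique_halfPlane_diff_box_neg hβc hμ m)
  have hae2 := (Measure.quasiMeasurePreserving_snd (μ := μ) (ν := μ')).ae (ae_starCluster_unique_halfPlane_diff_box hβc hμ' m)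
  have hincl : ∀ᵐ p ∂ν, p ∈ T ∩ PX ∩ PY → p ∈ ⋃ H : ℕ, {p | GoodAboveW m H x y p} := by
    filter_upwards [hae1, hae2] with p hum huq ⟨⟨hpT, hpX⟩, hpY⟩
    obtain ⟨H, hH⟩ := exists_goodAboveW_of_pin_touch' (ω := p.1) (ω' := p.2) hm hmn hy1 huq hum hpX hpY hpT
    exact Set.mem_iUnion.2 ⟨H, hH⟩
  have hU : cT * cx * cy ≤ (ν (⋃ H : ℕ, {p | GoodAboveW m H x y p})).toReal :=
    hprod.trans (ENNReal.toReal_mono (measure_ne_top _ _) (measure_mono_ae hincl))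
  have hmono : Monotone fun H : ℕ => {p : SpinConfig (Site 2) × SpinConfig (Site 2) | GoodAboveW m H x y p} := by
    intro H H' hH p ⟨α, hUα, hα⟩
    exact ⟨α, hUα, fun v hv => ⟨(hα v hv).1, box_mono 2 hH (hα v hv).2⟩⟩
  have hlim : Tendsto (fun H : ℕ => ν.real {p | GoodAboveW m H x y p}) atTop
      (𝓝 ((ν (⋃ H : ℕ, {p | GoodAboveW m H x y p})).toReal)) :=
    (ENNReal.tendsto_toReal (measure_ne_top _ _)).comp (tendsto_measure_iUnion_atTop hmono)
  obtain ⟨H₀, hH₀⟩ := eventually_atTop.1 (hlim.eventually (Ioi_mem_nhds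
    (show (ν (⋃ H : ℕ, {p | GoodAboveW m H x y p})).toReal - ε < (ν (⋃ H : ℕ, {p | GoodAboveW m H x y p})).toReal by
      linarith)))
  refine ⟨H₀, fun H hH => ?_⟩
  have h' : (ν (⋃ H : ℕ, {p | GoodAboveW m H x y p})).toReal - ε < ν.real {p | GoodAboveW m H x y p} := hH₀ H hH
  linarith

end Prob

end

end Literature.Probability.LatticeModels
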